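import Literature.AlgebraicGeometry.ModuliOfAbelianVarieties.SymplecticSimilitudeGroup
import Literature.AlgebraicGeometry.ModuliOfAbelianVarieties.SiegelSpaceComplexStructuresAction
import HarnessLib

/-!
# The Siegel double space as symplectic complex structures of either sign, the conjugation action of
# `GSp_δ(ℝ)`, and the Siegel Shimura set `GSp_δ(ℚ)∖(S^± × GSp_δ(𝔸_f)/K)`

Topic `AlgebraicGeometry/ModuliOfAbelianVarieties`; namespace `Literature.AlgebraicGeometry.ModuliOfAbelianVarieties`
(vocabulary: (σ1) `SymplecticSimilitudeGroup` — `IsMultiplier`, `similitudeGroupOfForm`, `gspRational/gspFinAdelic/gspReal δ`,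
`gspRationalToFinAdelic`, `gspRationalToReal`, `typeFormOver`; and Lange's ★ `SiegelModuli.realTypeForm δ = E_δ`, ★ `SiegelModuli.C0 δ`
(symplectic complex structures `J` with `ᵗJ E_δ ≻ 0`), ★ `SiegelModuli.spForm δ = Sp(E_δ)(ℝ)`, ★ `SiegelModuli.c0EquivSiegel : C0 δ ≃ 𝔥_g`).
DEFINITIONS WITH BODIES + bookkeeping lemmas ONLY: no named fact, no instance, no notation, no `sorry` (D-0014, typer lint).
Cell hodgecm-mathlib (D-0151), hDel line, leaf I-1′, layer (σ2) of `B-plan/I1prime-RECEPTACLE-PLAN.md` (B-plan2, PIN-B): the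
complex points of the Siegel modular variety `Sh_K(GSp, S^±)(ℂ) = GSp(ℚ)∖(S^± × GSp(𝔸_f)/K)` as a SET (the receptacle's `pts`
target in (σ3)).  HC_CM is proved only modulo the 7 printed citations until rung 0 closes; banked vocabulary, no floor change.

## The mathematics (printed)

[Milne2005ShimuraVarieties] §6 pp. 67–70: for a symplectic space `(V, ψ)`, `X = S^±` is the set of complex structures `J`
on `V(ℝ)` with `ψ(Ju, Jv) = ψ(u, v)` such that `ψ(u, Jv)` is positive OR negative definite — «the Siegel double space»,
a `GSp(ℝ)`-conjugacy class (`g` acts by `J ↦ gJg⁻¹`; similitudes of negative multiplier interchange `X⁺` and `X⁻`), and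
(5.1)/Lemma 5.13 p. 57: `Sh_K(G, X)(ℂ) = G(ℚ)∖(X × G(𝔸_f)/K)`, `G(ℚ)` acting diagonally (on `X` through `G(ℝ)`, on
`G(𝔸_f)/K` by left translation).  [Deligne1971TravauxShimura] 1.8 p. 129 / 4.16 p. 150 (the datum `(Gp(V), h₀)`);
[Deligne1979ShimuraVarieties] 1.3.1, 2.1.2.  In the tree's coordinates (a symplectic basis of type `δ`, Lange 2023 §7.1):
`X⁺ = C0 δ` (★ `SiegelModuli.C0`, in bijection with `𝔥_g` by ★ `c0EquivSiegel`), `X = C0pm δ := {J | J ∈ C0 δ ∨ -J ∈ C0 δ}`.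

## Main definitions (all with bodies)

* §0 consistency with (σ1): `typeFormOver δ ℝ = realTypeForm δ`, `spForm δ = symplecticGroupOfForm (typeFormOver δ ℝ) ≤ gspReal δ`.
* §1 `C0pm δ` (= `S^±`) and its two halves; §2 `conjJ M J = M J M⁻¹`, closure `conj_mem_C0pm` for `M ∈ gspReal δ`
  (multiplier `ν > 0` preserves the halves, `ν < 0` swaps them), `conjAct δ : gspReal δ → C0pm δ → C0pm δ` with
  `conjAct_one/_mul`, and the action packaged as a DEFINITION `gspRealAction δ : MulAction (gspReal δ) (C0pm δ)`
  (not an instance — typer lint; consumers bind it with `letI`).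
* §3 for `K ≤ GSp_δ(𝔸_f)`: the relation `siegelRel δ K` on `C0pm δ × (GSp_δ(𝔸_f) ⧸ K)` («`(J, aK) ∼ (J′, a′K)` iff some
  `γ ∈ GSp_δ(ℚ)` has `γJ′γ⁻¹ = J` and `γa′K = aK`»), its setoid, and `SiegelShimuraSet δ K` = the quotient, with `mk`,
  `mk_surjective`, `mk_eq_mk_iff`, `mk_conjAct_smul` (`[γJγ⁻¹, γaK] = [J, aK]`).

## Not here
The dissection of `SiegelShimuraSet δ K` into arithmetic quotients `Γ∖C0` indexed by `GSp(ℚ)₊∖GSp(𝔸_f)/K` ([Milne ISV]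
Lemma 5.13): the tree's generic ★ `ShimuraDissection` gives it once a consumer binds `gspRealAction` as a local instance
(a prover/(σ3) file); the `GSp(ℝ)`-action in Siegel coordinates (`moeb`; ★ `SiegelUpperHalfSpaceAction` has the
`Sp_{2g}(ℝ)` case) is likewise not needed for the receptacle's point set.

## References
* [Milne2005ShimuraVarieties] J. S. Milne, *Introduction to Shimura varieties* (2005), §5 (5.1), Lemma 5.13 p. 57; §6 pp. 67–70.
* [Deligne1971TravauxShimura] P. Deligne, *Travaux de Shimura* (1971), 1.8 p. 129, 4.16 p. 150.
* [Deligne1979ShimuraVarieties] P. Deligne, *Variétés de Shimura* (1979), 1.3.1, 2.1.2.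
* [Lange2023AbelianVarietiesComplex] H. Lange, *Abelian Varieties over the Complex Numbers* (2023), §7.1.2 (7.1)–(7.2), Prop. 7.1.9.
-/

set_option autoImplicit false

noncomputable section

open Matrix Topology NumberField IsDedekindDomain
open scoped ComplexOrder

namespace Literature.AlgebraicGeometry.ModuliOfAbelianVarieties

open Literature.NumberTheory.Automorphic (siegelUpperHalfSpace mem_siegelUpperHalfSpace_iff)
open SiegelModuli (realTypeForm C0 mem_C0_iff spForm mem_spForm_iff realTypeForm_eq_map_typeForm siegelOfJ siegelOfJ_mem
  jOfSiegel jOfSiegel_mem_C0)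

variable {g : ℕ}

/-! ### §0. Consistency of (σ1) with Lange's real objects -/

/-- The type-`δ` Gram matrix of (σ1) over `ℝ` IS Lange's `E_δ` (`realTypeForm δ`). [cite: Lange2023AbelianVarietiesComplex, §7.1.2 (p0326)] -/
theorem typeFormOver_real_eq_realTypeForm (δ : Fin g → ℕ) : typeFormOver δ ℝ = realTypeForm δ := by
  rw [realTypeForm_eq_map_typeForm]; rfl

/-- Lange's `Sp(V, E_δ)(ℝ)` (`spForm δ`, column convention) IS `Sp(E_δ)(ℝ)` of (σ1).
[cite: Lange2023AbelianVarietiesComplex, §7.1.2 Prop. 7.1.9 (p0328)] -/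
theorem spForm_eq_symplecticGroupOfForm (δ : Fin g → ℕ) : spForm δ = symplecticGroupOfForm (typeFormOver δ ℝ) := by
  ext M
  rw [mem_spForm_iff, mem_symplecticGroupOfForm_iff, typeFormOver_real_eq_realTypeForm]

/-- `Sp(E_δ)(ℝ) ≤ GSp_δ(ℝ)`. [cite: Milne2005ShimuraVarieties, §6 p. 67] -/
theorem spForm_le_gspReal (δ : Fin g → ℕ) : spForm δ ≤ gspReal δ := by
  rw [spForm_eq_symplecticGroupOfForm]
  exact symplecticGroupOfForm_le_similitudeGroupOfForm _

/-- A real similitude of type `δ` has a multiplier for `E_δ = realTypeForm δ`. [cite: Milne2005ShimuraVarieties, §6 p. 67] -/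
theorem exists_isMultiplier_realTypeForm {δ : Fin g → ℕ} {M : GL (Fin g ⊕ Fin g) ℝ} (hM : M ∈ gspReal δ) :
    ∃ ν : ℝˣ, IsMultiplier (realTypeForm δ) M ν := by
  rw [← typeFormOver_real_eq_realTypeForm]; exact hM

/-! ### §1. The Siegel double space as complex structures: `C0pm δ = C0 δ ⊔ (-C0 δ)` -/

/-- **`S^±` in Lange's model: symplectic complex structures of EITHER sign** — `J` with `J ∈ C0 δ` (`ᵗJ E_δ ≻ 0`, the `+`
half `X⁺ ≅ 𝔥_g`) or `-J ∈ C0 δ` (`ᵗJ E_δ ≺ 0`, the half `X⁻`).  This is the `GSp_δ(ℝ)`-conjugacy class of the base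
point ([Milne ISV] §6: «the set of complex structures `J` on `V(ℝ)` such that … positive or negative definite»).
[cite: Milne2005ShimuraVarieties, §6 pp. 68–70] [cite: Deligne1979ShimuraVarieties, 1.3.1] -/
def C0pm (δ : Fin g → ℕ) : Set (Matrix (Fin g ⊕ Fin g) (Fin g ⊕ Fin g) ℝ) :=
  {J | J ∈ C0 δ ∨ -J ∈ C0 δ}

/-- Membership in `C0pm δ`. [cite: Milne2005ShimuraVarieties, §6 p. 68] -/
theorem mem_C0pm_iff {δ : Fin g → ℕ} {J : Matrix (Fin g ⊕ Fin g) (Fin g ⊕ Fin g) ℝ} :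
    J ∈ C0pm δ ↔ J ∈ C0 δ ∨ -J ∈ C0 δ :=
  Iff.rfl

/-- `X⁺ ⊆ X`. [cite: Milne2005ShimuraVarieties, §6 p. 68] -/
theorem C0_subset_C0pm (δ : Fin g → ℕ) : C0 δ ⊆ C0pm δ := fun _ h => Or.inl h

/-- `X` is stable under `J ↦ -J` (complex conjugation of the structure; it swaps the halves). [cite: Milne2005ShimuraVarieties, §6 p. 68] -/
theorem neg_mem_C0pm {δ : Fin g → ℕ} {J : Matrix (Fin g ⊕ Fin g) (Fin g ⊕ Fin g) ℝ} (hJ : J ∈ C0pm δ) : -J ∈ C0pm δ := by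
  rcases hJ with h | h
  · exact Or.inr (by rwa [neg_neg])
  · exact Or.inl h

/-- The two halves are disjoint (for `g ≥ 1`): `ᵗJ E_δ` cannot be positive and negative definite at once.
[cite: Milne2005ShimuraVarieties, §6 p. 68 («X = X⁺ ⊔ X⁻»)] -/
theorem neg_not_mem_C0_of_mem_C0 {δ : Fin g → ℕ} (hg : 0 < g) {J : Matrix (Fin g ⊕ Fin g) (Fin g ⊕ Fin g) ℝ}
    (hJ : J ∈ C0 δ) : -J ∉ C0 δ := by
  intro hJ'
  haveI : Nonempty (Fin g ⊕ Fin g) := ⟨Sum.inl ⟨0, hg⟩⟩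
  have h1 : 0 < (Jᵀ * realTypeForm δ).trace := (mem_C0_iff.1 hJ).2.trace_pos
  have h2 : 0 < ((-J)ᵀ * realTypeForm δ).trace := (mem_C0_iff.1 hJ').2.trace_pos
  rw [transpose_neg, Matrix.neg_mul, trace_neg] at h2
  linarith

/-- **Bridge to Siegel coordinates on the `+` half**: `J ∈ C0 δ ↦ Z_J ∈ 𝔥_g` (★ `siegelOfJ`), so every point of `X`
gives a point of `𝔥_g^±` — `Z_J` if `J ∈ X⁺`, `-Z_{-J}` if `J ∈ X⁻`.  (A set-level chart; the `GSp(ℝ)`-equivariant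
identification is ★ `jOfSiegel_moeb` on `X⁺`.) [cite: Lange2023AbelianVarietiesComplex, §7.1.2 (7.2) (p0327)] -/
theorem exists_mem_siegelDoubleSpace_of_mem_C0pm {δ : Fin g → ℕ} {J : Matrix (Fin g ⊕ Fin g) (Fin g ⊕ Fin g) ℝ}
    (hJ : J ∈ C0pm δ) : (J ∈ C0 δ ∧ siegelOfJ δ J ∈ siegelDoubleSpace g) ∨ (-J ∈ C0 δ ∧ -siegelOfJ δ (-J) ∈ siegelDoubleSpace g) := by
  rcases hJ with h | h
  · exact Or.inl ⟨h, siegelUpperHalfSpace_subset_siegelDoubleSpace g (siegelOfJ_mem h)⟩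
  · exact Or.inr ⟨h, neg_mem_siegelDoubleSpace (siegelUpperHalfSpace_subset_siegelDoubleSpace g (siegelOfJ_mem h))⟩

/-- **Non-vacuity**: for a genuine polarisation type (`δᵢ ≥ 1`) the base point `J_{i·1_g}` lies in `X` (★ `jOfSiegel_mem_C0`
at `i·1_g ∈ 𝔥_g`). [cite: Lange2023AbelianVarietiesComplex, §7.1.2 Lemma 7.1.6 (2) (p0327)] -/
theorem jOfSiegel_I_smul_one_mem_C0pm {δ : Fin g → ℕ} (hδ : ∀ i, 0 < δ i) :
    jOfSiegel δ (Complex.I • (1 : Matrix (Fin g) (Fin g) ℂ)) ∈ C0pm δ :=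
  C0_subset_C0pm δ (jOfSiegel_mem_C0 hδ (I_smul_one_mem_siegelUpperHalfSpace g))

/-- `X` is non-empty for `δᵢ ≥ 1`. [cite: Milne2005ShimuraVarieties, §6 p. 68] -/
theorem nonempty_C0pm {δ : Fin g → ℕ} (hδ : ∀ i, 0 < δ i) : (C0pm δ).Nonempty :=
  ⟨_, jOfSiegel_I_smul_one_mem_C0pm hδ⟩

/-! ### §2. The conjugation action of `GSp_δ(ℝ)` on `X = C0pm δ` -/

/-- Conjugation of a matrix by an invertible one: `conjJ M J = M J M⁻¹` (the action `J ↦ gJg⁻¹` of `GL(V)(ℝ)` on complex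
structures). [cite: Milne2005ShimuraVarieties, §6 p. 68] -/
def conjJ (M : GL (Fin g ⊕ Fin g) ℝ) (J : Matrix (Fin g ⊕ Fin g) (Fin g ⊕ Fin g) ℝ) : Matrix (Fin g ⊕ Fin g) (Fin g ⊕ Fin g) ℝ :=
  (M : Matrix (Fin g ⊕ Fin g) (Fin g ⊕ Fin g) ℝ) * J * ((M⁻¹ : GL (Fin g ⊕ Fin g) ℝ) : Matrix (Fin g ⊕ Fin g) (Fin g ⊕ Fin g) ℝ)

/-- Unfolding of `conjJ`. [cite: Milne2005ShimuraVarieties, §6 p. 68] -/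
theorem conjJ_def (M : GL (Fin g ⊕ Fin g) ℝ) (J : Matrix (Fin g ⊕ Fin g) (Fin g ⊕ Fin g) ℝ) :
    conjJ M J = (M : Matrix (Fin g ⊕ Fin g) (Fin g ⊕ Fin g) ℝ) * J * ((M⁻¹ : GL (Fin g ⊕ Fin g) ℝ) : Matrix (Fin g ⊕ Fin g) (Fin g ⊕ Fin g) ℝ) :=
  rfl

/-- `conjJ 1 J = J`. [cite: Milne2005ShimuraVarieties, §6 p. 68] -/
@[simp] theorem conjJ_one (J : Matrix (Fin g ⊕ Fin g) (Fin g ⊕ Fin g) ℝ) : conjJ (1 : GL (Fin g ⊕ Fin g) ℝ) J = J := by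
  rw [conjJ, inv_one, Units.val_one, Matrix.one_mul, Matrix.mul_one]

/-- `conjJ (M N) J = conjJ M (conjJ N J)`. [cite: Milne2005ShimuraVarieties, §6 p. 68] -/
theorem conjJ_mul (M N : GL (Fin g ⊕ Fin g) ℝ) (J : Matrix (Fin g ⊕ Fin g) (Fin g ⊕ Fin g) ℝ) :
    conjJ (M * N) J = conjJ M (conjJ N J) := by
  simp only [conjJ, _root_.mul_inv_rev, Units.val_mul, Matrix.mul_assoc]

/-- `conjJ M (-J) = -conjJ M J`. [cite: Milne2005ShimuraVarieties, §6 p. 68] -/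
theorem conjJ_neg (M : GL (Fin g ⊕ Fin g) ℝ) (J : Matrix (Fin g ⊕ Fin g) (Fin g ⊕ Fin g) ℝ) : conjJ M (-J) = -conjJ M J := by
  simp only [conjJ, Matrix.mul_neg, Matrix.neg_mul]

/-- `(M J M⁻¹)² = -1` if `J² = -1`. [cite: Lange2023AbelianVarietiesComplex, §7.1.2 Prop. 7.1.9 (p0328)] -/
theorem conjJ_mul_self {M : GL (Fin g ⊕ Fin g) ℝ} {J : Matrix (Fin g ⊕ Fin g) (Fin g ⊕ Fin g) ℝ} (hJ : J * J = -1) :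
    conjJ M J * conjJ M J = -1 := by
  have hMM : ((M⁻¹ : GL (Fin g ⊕ Fin g) ℝ) : Matrix (Fin g ⊕ Fin g) (Fin g ⊕ Fin g) ℝ) *
      (M : Matrix (Fin g ⊕ Fin g) (Fin g ⊕ Fin g) ℝ) = 1 := Units.inv_mul M
  have hMM' : (M : Matrix (Fin g ⊕ Fin g) (Fin g ⊕ Fin g) ℝ) *
      ((M⁻¹ : GL (Fin g ⊕ Fin g) ℝ) : Matrix (Fin g ⊕ Fin g) (Fin g ⊕ Fin g) ℝ) = 1 := Units.mul_inv M
  calc conjJ M J * conjJ M J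
      = (M : Matrix (Fin g ⊕ Fin g) (Fin g ⊕ Fin g) ℝ) * (J * (((M⁻¹ : GL (Fin g ⊕ Fin g) ℝ) : Matrix (Fin g ⊕ Fin g) (Fin g ⊕ Fin g) ℝ) *
          (M : Matrix (Fin g ⊕ Fin g) (Fin g ⊕ Fin g) ℝ)) * J) * ((M⁻¹ : GL (Fin g ⊕ Fin g) ℝ) : Matrix (Fin g ⊕ Fin g) (Fin g ⊕ Fin g) ℝ) := by
        simp only [conjJ, Matrix.mul_assoc]
    _ = -1 := by rw [hMM, Matrix.mul_one, hJ, Matrix.mul_neg, Matrix.mul_one, Matrix.neg_mul, hMM']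

/-- **The key identity**: for a similitude `M` with `ᵗM E_δ M = ν E_δ`, `ᵗ(M J M⁻¹) E_δ = ν • (ᵗ(M⁻¹) (ᵗJ E_δ) M⁻¹)` — the
symmetric form of `M J M⁻¹` is `ν` times a congruent of that of `J`. [cite: Milne2005ShimuraVarieties, §6 p. 68]
[cite: Lange2023AbelianVarietiesComplex, §7.1.2 Prop. 7.1.9 (p0328)] -/
theorem transpose_conjJ_mul_realTypeForm {δ : Fin g → ℕ} {M : GL (Fin g ⊕ Fin g) ℝ} {ν : ℝˣ}
    (hM : IsMultiplier (realTypeForm δ) M ν) (J : Matrix (Fin g ⊕ Fin g) (Fin g ⊕ Fin g) ℝ) :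
    (conjJ M J)ᵀ * realTypeForm δ =
      (ν : ℝ) • (star ((M⁻¹ : GL (Fin g ⊕ Fin g) ℝ) : Matrix (Fin g ⊕ Fin g) (Fin g ⊕ Fin g) ℝ) * (Jᵀ * realTypeForm δ) *
        ((M⁻¹ : GL (Fin g ⊕ Fin g) ℝ) : Matrix (Fin g ⊕ Fin g) (Fin g ⊕ Fin g) ℝ)) := by
  rw [isMultiplier_iff] at hM
  have hMM' : (M : Matrix (Fin g ⊕ Fin g) (Fin g ⊕ Fin g) ℝ) *
      ((M⁻¹ : GL (Fin g ⊕ Fin g) ℝ) : Matrix (Fin g ⊕ Fin g) (Fin g ⊕ Fin g) ℝ) = 1 := Units.mul_inv M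
  rw [star_eq_conjTranspose, conjTranspose_eq_transpose_of_trivial, conjJ, transpose_mul, transpose_mul]
  calc ((M⁻¹ : GL (Fin g ⊕ Fin g) ℝ) : Matrix (Fin g ⊕ Fin g) (Fin g ⊕ Fin g) ℝ)ᵀ * (Jᵀ * (M : Matrix (Fin g ⊕ Fin g) (Fin g ⊕ Fin g) ℝ)ᵀ) *
        realTypeForm δ
      = ((M⁻¹ : GL (Fin g ⊕ Fin g) ℝ) : Matrix (Fin g ⊕ Fin g) (Fin g ⊕ Fin g) ℝ)ᵀ * (Jᵀ * (M : Matrix (Fin g ⊕ Fin g) (Fin g ⊕ Fin g) ℝ)ᵀ) *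
          realTypeForm δ * ((M : Matrix (Fin g ⊕ Fin g) (Fin g ⊕ Fin g) ℝ) *
          ((M⁻¹ : GL (Fin g ⊕ Fin g) ℝ) : Matrix (Fin g ⊕ Fin g) (Fin g ⊕ Fin g) ℝ)) := by
        rw [hMM', Matrix.mul_one]
    _ = ((M⁻¹ : GL (Fin g ⊕ Fin g) ℝ) : Matrix (Fin g ⊕ Fin g) (Fin g ⊕ Fin g) ℝ)ᵀ * Jᵀ *
          ((M : Matrix (Fin g ⊕ Fin g) (Fin g ⊕ Fin g) ℝ)ᵀ * realTypeForm δ * (M : Matrix (Fin g ⊕ Fin g) (Fin g ⊕ Fin g) ℝ)) *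
          ((M⁻¹ : GL (Fin g ⊕ Fin g) ℝ) : Matrix (Fin g ⊕ Fin g) (Fin g ⊕ Fin g) ℝ) := by
        simp only [Matrix.mul_assoc]
    _ = (ν : ℝ) • (((M⁻¹ : GL (Fin g ⊕ Fin g) ℝ) : Matrix (Fin g ⊕ Fin g) (Fin g ⊕ Fin g) ℝ)ᵀ * (Jᵀ * realTypeForm δ) *
          ((M⁻¹ : GL (Fin g ⊕ Fin g) ℝ) : Matrix (Fin g ⊕ Fin g) (Fin g ⊕ Fin g) ℝ)) := by
        rw [hM, Matrix.mul_smul, Matrix.smul_mul]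
        simp only [Matrix.mul_assoc]

/-- **Positive multiplier: conjugation preserves the `+` half.** [cite: Milne2005ShimuraVarieties, §6 p. 68]
[cite: Lange2023AbelianVarietiesComplex, §7.1.2 Prop. 7.1.9 (p0328)] -/
theorem conjJ_mem_C0_of_pos {δ : Fin g → ℕ} {M : GL (Fin g ⊕ Fin g) ℝ} {ν : ℝˣ}
    (hM : IsMultiplier (realTypeForm δ) M ν) (hν : 0 < (ν : ℝ)) {J : Matrix (Fin g ⊕ Fin g) (Fin g ⊕ Fin g) ℝ}
    (hJ : J ∈ C0 δ) : conjJ M J ∈ C0 δ := by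
  rw [mem_C0_iff] at hJ ⊢
  refine ⟨conjJ_mul_self hJ.1, ?_⟩
  rw [transpose_conjJ_mul_realTypeForm hM]
  have hMi : IsUnit ((M⁻¹ : GL (Fin g ⊕ Fin g) ℝ) : Matrix (Fin g ⊕ Fin g) (Fin g ⊕ Fin g) ℝ) := ⟨M⁻¹, rfl⟩
  exact ((Matrix.IsUnit.posDef_star_left_conjugate_iff hMi).2 hJ.2).smul hν

/-- **Negative multiplier: conjugation swaps the halves** (`M J M⁻¹ ∈ X⁻` for `J ∈ X⁺`). [cite: Milne2005ShimuraVarieties, §6 p. 68] -/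
theorem neg_conjJ_mem_C0_of_neg {δ : Fin g → ℕ} {M : GL (Fin g ⊕ Fin g) ℝ} {ν : ℝˣ}
    (hM : IsMultiplier (realTypeForm δ) M ν) (hν : (ν : ℝ) < 0) {J : Matrix (Fin g ⊕ Fin g) (Fin g ⊕ Fin g) ℝ}
    (hJ : J ∈ C0 δ) : -conjJ M J ∈ C0 δ := by
  rw [mem_C0_iff] at hJ ⊢
  refine ⟨by rw [Matrix.neg_mul, Matrix.mul_neg, neg_neg, conjJ_mul_self hJ.1], ?_⟩
  rw [transpose_neg, Matrix.neg_mul, transpose_conjJ_mul_realTypeForm hM, ← neg_smul]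
  have hMi : IsUnit ((M⁻¹ : GL (Fin g ⊕ Fin g) ℝ) : Matrix (Fin g ⊕ Fin g) (Fin g ⊕ Fin g) ℝ) := ⟨M⁻¹, rfl⟩
  exact ((Matrix.IsUnit.posDef_star_left_conjugate_iff hMi).2 hJ.2).smul (neg_pos.2 hν)

/-- **`GSp_δ(ℝ)` acts on `X = C0pm δ` by conjugation** (closure): for `M ∈ gspReal δ` and `J ∈ X`, `M J M⁻¹ ∈ X`.
[cite: Milne2005ShimuraVarieties, §6 pp. 68–70] -/
theorem conjJ_mem_C0pm {δ : Fin g → ℕ} {M : GL (Fin g ⊕ Fin g) ℝ} (hM : M ∈ gspReal δ)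
    {J : Matrix (Fin g ⊕ Fin g) (Fin g ⊕ Fin g) ℝ} (hJ : J ∈ C0pm δ) : conjJ M J ∈ C0pm δ := by
  obtain ⟨ν, hν⟩ := exists_isMultiplier_realTypeForm hM
  rcases lt_or_gt_of_ne (Units.ne_zero ν) with hneg | hpos
  · rcases hJ with h | h
    · exact Or.inr (neg_conjJ_mem_C0_of_neg hν hneg h)
    · refine Or.inl ?_
      have := neg_conjJ_mem_C0_of_neg hν hneg h
      rwa [conjJ_neg, neg_neg] at this
  · rcases hJ with h | h
    · exact Or.inl (conjJ_mem_C0_of_pos hν hpos h)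
    · refine Or.inr ?_
      have := conjJ_mem_C0_of_pos hν hpos h
      rwa [conjJ_neg] at this

/-- The action map `GSp_δ(ℝ) × X → X`, `(M, J) ↦ M J M⁻¹`, on the subtype. [cite: Milne2005ShimuraVarieties, §6 p. 68] -/
def conjAct (δ : Fin g → ℕ) (M : gspReal δ) (J : C0pm δ) : C0pm δ :=
  ⟨conjJ (M : GL (Fin g ⊕ Fin g) ℝ) J, conjJ_mem_C0pm M.2 J.2⟩

/-- `conjAct` on matrices. [cite: Milne2005ShimuraVarieties, §6 p. 68] -/
@[simp] theorem coe_conjAct (δ : Fin g → ℕ) (M : gspReal δ) (J : C0pm δ) :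
    ((conjAct δ M J : C0pm δ) : Matrix (Fin g ⊕ Fin g) (Fin g ⊕ Fin g) ℝ) = conjJ (M : GL (Fin g ⊕ Fin g) ℝ) J :=
  rfl

/-- `conjAct 1 = id`. [cite: Milne2005ShimuraVarieties, §6 p. 68] -/
@[simp] theorem conjAct_one (δ : Fin g → ℕ) (J : C0pm δ) : conjAct δ 1 J = J :=
  Subtype.ext (by rw [coe_conjAct, OneMemClass.coe_one, conjJ_one])

/-- `conjAct (M N) = conjAct M ∘ conjAct N`. [cite: Milne2005ShimuraVarieties, §6 p. 68] -/
theorem conjAct_mul (δ : Fin g → ℕ) (M N : gspReal δ) (J : C0pm δ) : conjAct δ (M * N) J = conjAct δ M (conjAct δ N J) :=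
  Subtype.ext (by rw [coe_conjAct, coe_conjAct, coe_conjAct, Subgroup.coe_mul, conjJ_mul])

/-- **The conjugation action of `GSp_δ(ℝ)` on `X`, packaged as a `MulAction` STRUCTURE (a definition, deliberately NOT an
instance: bind it with `letI := gspRealAction δ` where the generic `ShimuraDissection` is wanted).**
[cite: Milne2005ShimuraVarieties, §6 pp. 68–70] -/
@[reducible] def gspRealAction (δ : Fin g → ℕ) : MulAction (gspReal δ) (C0pm δ) where
  smul := conjAct δ
  one_smul := conjAct_one δ
  mul_smul := conjAct_mul δ

/-! ### §3. The Siegel Shimura set `GSp_δ(ℚ)∖(X × GSp_δ(𝔸_f)/K)` -/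

section ShimuraSet

variable (δ : Fin g → ℕ) (K : Subgroup (gspFinAdelic δ))

/-- The relation «same `GSp_δ(ℚ)`-orbit» on `X × GSp_δ(𝔸_f)/K`: `(J, q) ∼ (J′, q′)` iff some `γ ∈ GSp_δ(ℚ)` satisfies
`γ_ℝ J′ γ_ℝ⁻¹ = J` and `γ_𝔸 • q′ = q` (`GSp(ℚ)` acts on `X` through `GSp(ℝ)` and on `GSp(𝔸_f)/K` by left translation).
[cite: Milne2005ShimuraVarieties, §5 p. 57 and Lemma 5.13 p. 57] -/
def siegelRel (x y : C0pm δ × (gspFinAdelic δ ⧸ K)) : Prop :=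
  ∃ γ : gspRational δ, conjAct δ (gspRationalToReal δ γ) y.1 = x.1 ∧ gspRationalToFinAdelic δ γ • y.2 = x.2

/-- `siegelRel` is reflexive (`γ = 1`). [cite: Milne2005ShimuraVarieties, §5 p. 57] -/
theorem siegelRel_refl (x : C0pm δ × (gspFinAdelic δ ⧸ K)) : siegelRel δ K x x :=
  ⟨1, by rw [map_one, conjAct_one], by rw [map_one, one_smul]⟩

/-- `siegelRel` is symmetric (`γ ↦ γ⁻¹`). [cite: Milne2005ShimuraVarieties, §5 p. 57] -/
theorem siegelRel_symm {x y : C0pm δ × (gspFinAdelic δ ⧸ K)} (h : siegelRel δ K x y) : siegelRel δ K y x := by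
  obtain ⟨γ, h1, h2⟩ := h
  refine ⟨γ⁻¹, ?_, ?_⟩
  · rw [← h1, ← conjAct_mul, ← map_mul, inv_mul_cancel, map_one, conjAct_one]
  · rw [← h2, smul_smul, ← map_mul, inv_mul_cancel, map_one, one_smul]

/-- `siegelRel` is transitive (`γ γ′`). [cite: Milne2005ShimuraVarieties, §5 p. 57] -/
theorem siegelRel_trans {x y z : C0pm δ × (gspFinAdelic δ ⧸ K)} (hxy : siegelRel δ K x y) (hyz : siegelRel δ K y z) :
    siegelRel δ K x z := by
  obtain ⟨γ, h1, h2⟩ := hxy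
  obtain ⟨γ', h1', h2'⟩ := hyz
  refine ⟨γ * γ', ?_, ?_⟩
  · rw [map_mul, conjAct_mul, h1', h1]
  · rw [map_mul, ← smul_smul, h2', h2]

/-- The orbit setoid of `GSp_δ(ℚ)` on `X × GSp_δ(𝔸_f)/K`. [cite: Milne2005ShimuraVarieties, §5 p. 57] -/
def siegelSetoid : Setoid (C0pm δ × (gspFinAdelic δ ⧸ K)) where
  r := siegelRel δ K
  iseqv := ⟨siegelRel_refl δ K, siegelRel_symm δ K, siegelRel_trans δ K⟩

/-- **The Siegel Shimura set `Sh_K(GSp_δ, S^±)(ℂ) = GSp_δ(ℚ)∖(S^± × GSp_δ(𝔸_f)/K)`** — the complex points of the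
Siegel modular variety at level `K` as a set ([Milne ISV] (5.1), §6 p. 70 «The Siegel modular variety attached to `(V, ψ)`
is the Shimura variety `Sh(G, X)`»; its points classify polarised abelian varieties with level structure up to the moduli
interpretation of [Milne ISV] Thm. 6.11 / [Deligne 1971] 4.16 — not asserted here).
[cite: Milne2005ShimuraVarieties, §5 p. 57, §6 p. 70, Thm. 6.11 p. 74] [cite: Deligne1971TravauxShimura, 1.8 p. 129, 4.16 p. 150] -/
def SiegelShimuraSet : Type :=
  Quotient (siegelSetoid δ K)

/-- The class `[J, aK] ∈ Sh_K(GSp_δ, S^±)(ℂ)` of a complex structure `J ∈ X` and a finite-adelic point `a`.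
[cite: Milne2005ShimuraVarieties, §5 p. 57] -/
def SiegelShimuraSet.mk (J : C0pm δ) (a : gspFinAdelic δ) : SiegelShimuraSet δ K :=
  Quotient.mk (siegelSetoid δ K) (J, (a : gspFinAdelic δ ⧸ K))

/-- Every point of `Sh_K(GSp_δ, S^±)(ℂ)` is a class `[J, aK]`. [cite: Milne2005ShimuraVarieties, §5 p. 57] -/
theorem SiegelShimuraSet.mk_surjective : Function.Surjective (Function.uncurry (SiegelShimuraSet.mk δ K)) := by
  intro c
  induction c using Quotient.inductionOn with | h p => ?_
  obtain ⟨J, q⟩ := p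
  induction q using QuotientGroup.induction_on with | H a => ?_
  exact ⟨(J, a), rfl⟩

/-- `[J, aK] = [J′, a′K] ↔ ∃ γ ∈ GSp_δ(ℚ), γJ′γ⁻¹ = J ∧ γ a′K = aK`. [cite: Milne2005ShimuraVarieties, §5 p. 57, Lemma 5.13 p. 57] -/
theorem SiegelShimuraSet.mk_eq_mk_iff (J J' : C0pm δ) (a a' : gspFinAdelic δ) :
    SiegelShimuraSet.mk δ K J a = SiegelShimuraSet.mk δ K J' a' ↔
      ∃ γ : gspRational δ, conjAct δ (gspRationalToReal δ γ) J' = J ∧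
        gspRationalToFinAdelic δ γ • (a' : gspFinAdelic δ ⧸ K) = (a : gspFinAdelic δ ⧸ K) :=
  Quotient.eq (r := siegelSetoid δ K)

/-- **`GSp_δ(ℚ)`-invariance of the class**: `[γJγ⁻¹, γa K] = [J, aK]` for `γ ∈ GSp_δ(ℚ)`. [cite: Milne2005ShimuraVarieties, §5 p. 57] -/
theorem SiegelShimuraSet.mk_conjAct_smul (γ : gspRational δ) (J : C0pm δ) (a : gspFinAdelic δ) :
    SiegelShimuraSet.mk δ K (conjAct δ (gspRationalToReal δ γ) J) ((gspRationalToFinAdelic δ γ : gspFinAdelic δ) * a) =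
      SiegelShimuraSet.mk δ K J a := by
  rw [SiegelShimuraSet.mk_eq_mk_iff]
  exact ⟨γ, rfl, rfl⟩

/-- **Non-vacuity**: `Sh_K(GSp_δ, S^±)(ℂ)` is non-empty for `δᵢ ≥ 1` (the class of the base point and `a = 1`).
[cite: Milne2005ShimuraVarieties, §5 p. 57] -/
theorem nonempty_siegelShimuraSet (hδ : ∀ i, 0 < δ i) : Nonempty (SiegelShimuraSet δ K) :=
  ⟨SiegelShimuraSet.mk δ K ⟨_, jOfSiegel_I_smul_one_mem_C0pm hδ⟩ 1⟩

end ShimuraSet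

end Literature.AlgebraicGeometry.ModuliOfAbelianVarieties

end
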